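import Literature.Barriers.CriticalPhenomena.GridSAWLOTDrawing
import Literature.Barriers.CriticalPhenomena.GridSAWLOTProfileFP
import Literature.Barriers.CriticalPhenomena.GridSAWTiledDrawingData
import HarnessLib

/-!
# The grid drawing of the `#3SAT → #HamPath` gadget graph, IV: its data in typed polynomial time

The machine half of `GridSAW.LOT2003_lemma4_gadgets` (Liśkiewicz–Ogihara–Toda 2003, Lemma 4 with the
embedding of the proof of Theorem 7: "It is not hard to see that `R` is polynomial-time
computable") for the construction of `GridSAWLOTDrawing.lean`. The placements of that file are
re-expressed as PLACEMENT DATA (`PData`, `GridSAWTiledDrawingData.lean`) computed from the profile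
of the formula (`GridSAWLOTProfileFP.lean`): each kind of tile is `mkPD (tile data of the flags)
(anchors) (origin)` with the flags, anchors and origin the values of fixed arithmetic expressions
(`CodeFP.AExp`) in the environment `LOTProfile.env φ i`, so that the whole list is typed polynomial
time in the code of `φ` by the closure properties of `CodeFP`.

* `TileData`, `nusOf`, `mkPD`, `codeFP_mkPD`;
* `sitePDF`, `dummyPDF`, `k0PDF`, `clausePDF`, `zPDF` with `*_env : … = PData.ofPlacement (…)`
  and `codeFP_*`;
* **`pdataList`**, **`pdataList_eq : pdataList φ = (placements φ).map PData.ofPlacement`**,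
  **`codeFP_pdataList`**;
* `totalV_le`, `codeFP_uTotalV`, `codeFP_tEnd` (the number of vertices in unary, the far end); the
  drawing itself and `codeFP_drawingData` are assembled in
  `GridSAWCountingGridHamPathHardnessProofs.lean`.

## References

* M. Liśkiewicz, M. Ogihara, S. Toda, TCS 304 (2003) 129–156, §3 (proof of Lemma 4), §4 (`E₀`).
* S. Arora, B. Barak, *Computational Complexity: A Modern Approach*, CUP 2009, §1.3.
-/

namespace Literature.Barriers.CriticalPhenomena.GridSAW

namespace LOTDrawingFP

open _root_.Computability Literature.Computability.Complexity Literature.Computability.Complexity.CodeFP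
open Literature.Combinatorics.SimpleGraph Literature.Combinatorics.SimpleGraph.LOTReduction
open LOTTiles LOTDrawing LOTProfile PData GridFormulaFP

/-! ### Placement data from tile data, anchors and origin -/

/-- **Tile data**: local positions, local edges, numbering keys. [folklore] -/
abbrev TileData : Type := List GridPoint × List (ℕ × ℕ × List GridPoint) × List (ℕ × ℕ)

/-- The raw code of tile data. [cite: AroraBarak2009, §0.1] -/
abbrev tdC : TileData → List Bool := pairE (rawE gpC) (pairE (rawE sedgeC) (rawE (pairE natE natE)))

/-- The global names of the local vertices: anchor of the key plus offset. [folklore] -/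
def nusOf (pos : List GridPoint) (num : List (ℕ × ℕ)) (A : List ℕ) : List ℕ :=
  (List.range pos.length).map fun i => A.getD (num.getD i (0, 0)).1 0 + (num.getD i (0, 0)).2

/-- **Placement data from tile data, anchors and origin.** [folklore] -/
def mkPD (td : TileData) (A : List ℕ) (o : GridPoint) : PData := (td.1, td.2.1, o, nusOf td.1 td.2.2 A)

/-- A `mapIdx` ignoring the items is a map over the range of indices. [folklore] -/
theorem mapIdx_const {α β : Type} (l : List α) (f : ℕ → β) : l.mapIdx (fun i _ => f i) = (List.range l.length).map f := by
  apply List.ext_getElem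
  · simp
  · intro n h1 h2; simp

/-- **`mkPD` is typed polynomial time.** [cite: AroraBarak2009, §1.3] -/
theorem codeFP_mkPD : CodeFP (pairE tdC (pairE (rawE natE) gpC)) pdC (fun q => mkPD q.1 q.2.1 q.2.2) := by
  -- (no type ascriptions on the intermediate maps: unification through `List.getD` is expensive)
  -- the name of local vertex `i` (context: keys and anchors; item: index and position)
  have hk := (rawGetOr (pairE natE natE)).comp
    ((fst (pairE (rawE (pairE natE natE)) (rawE natE)) (pairE natE gpC)).fst'.pair
      ((snd (pairE (rawE (pairE natE natE)) (rawE natE)) (pairE natE gpC)).fst'.pair (const _ ((0 : ℕ), (0 : ℕ)))))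
  have hg := natAdd.comp (((rawGetD natE (d := 0) rfl).comp
    ((fst (pairE (rawE (pairE natE natE)) (rawE natE)) (pairE natE gpC)).snd'.pair hk.fst')).pair hk.snd')
  have hν := mapIdx (σ := List (ℕ × ℕ) × List ℕ) (eσ := pairE (rawE (pairE natE natE)) (rawE natE)) (eα := gpC) hg
  have hctx : CodeFP (pairE tdC (pairE (rawE natE) gpC)) (pairE (pairE (rawE (pairE natE natE)) (rawE natE)) (rawE gpC))
      (fun q => ((q.1.2.2, q.2.1), q.1.1)) := ((fst _ _).snd'.snd'.pair (snd _ _).fst').pair (fst _ _).fst'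
  have hpos : CodeFP (pairE tdC (pairE (rawE natE) gpC)) (rawE gpC) (fun q => q.1.1) := (fst _ _).fst'
  have hE : CodeFP (pairE tdC (pairE (rawE natE) gpC)) (rawE sedgeC) (fun q => q.1.2.1) := (fst _ _).snd'.fst'
  have ho : CodeFP (pairE tdC (pairE (rawE natE) gpC)) gpC (fun q => q.2.2) := (snd _ _).snd'
  refine (hpos.pair (hE.pair (ho.pair (hν.comp hctx)))).congr fun q => ?_
  simp only [mkPD, nusOf, mapIdx_const]

/-- Anchored names agree with a numbering whose keys stay below the number of anchors. [folklore] -/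
theorem nusOf_eq {pos : List GridPoint} {num : List (ℕ × ℕ)} {n : ℕ} (anchor : ℕ → ℕ) (hn : 0 < n) (hkeys : ∀ k ∈ num, k.1 < n) :
    nusOf pos num ((List.range n).map anchor) = (List.range pos.length).map fun i => anchor (num.getD i (0, 0)).1 + (num.getD i (0, 0)).2 := by
  unfold nusOf
  refine List.map_congr_left fun i _ => ?_
  have hlt : (num.getD i (0, 0)).1 < n := by
    by_cases hi : i < num.length
    · rw [List.getD_eq_getElem _ _ hi]; exact hkeys _ (List.getElem_mem hi)
    · rw [List.getD_eq_default _ _ (not_lt.1 hi)]; exact hn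
  rw [PData.getD_map_range _ hlt]

/-! ### Keys of the tiles stay below the number of anchors (by `decide`) -/

/-- Site keys use anchors `0 … 6`. [folklore] -/
theorem keys_site (f l t s0 s1 : Bool) : ∀ k ∈ siteNum f l t s0 s1, k.1 < 7 := by
  cases f <;> cases l <;> cases t <;> cases s0 <;> cases s1 <;> decide

/-- Dummy-pair keys use anchors `0 … 4`. [folklore] -/
theorem keys_dummy (f l v : Bool) : ∀ k ∈ dummyNum f l v, k.1 < 5 := by
  cases f <;> cases l <;> cases v <;> decide

/-- `K_0` keys use anchors `0 … 2`. [folklore] -/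
theorem keys_k0 (p : Bool) : ∀ k ∈ k0Num p, k.1 < 3 := by cases p <;> decide

/-- Clause keys use anchors `0 … 2`. [folklore] -/
theorem keys_clause (p0 p1 p2 : Bool) : ∀ k ∈ clauseNum p0 p1 p2, k.1 < 3 := by
  cases p0 <;> cases p1 <;> cases p2 <;> decide

/-- End-tile keys use anchor `0`. [folklore] -/
theorem keys_z : ∀ k ∈ zNum, k.1 < 1 := by decide

/-! ### Sites -/

/-- The row of site index `i`. [folklore] -/
def eR : AExp := .div eIdx eN
/-- The position of site index `i`. [folklore] -/
def eS : AExp := .emod eIdx eN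

/-- `first`: `s = 0`. [folklore] -/
def fE : AExp := .beq eS (.lit 0)
/-- `last`: `s + 1 = N`. [folklore] -/
def lE : AExp := .beq (.add eS (.lit 1)) eN
/-- `tap`: the column through the site taps here. [folklore] -/
def tE : AExp := eTap eR (eJ eR eS)
/-- `set0`, first half: `s = J r r`. [folklore] -/
def s0E : AExp := .beq eS (eJ eR eR)
/-- `set1`, first half: `0 < s`. [folklore] -/
def s1aE : AExp := .lt (.lit 0) eS
/-- `set1`, second half: `s - 1 = J r r`. [folklore] -/
def s1bE : AExp := .beq (.sub eS (.lit 1)) (eJ eR eR)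
/-- `isSome r`. [folklore] -/
def smE' : AExp := eIsSome eR
/-- `mirrored`: `r` even. [folklore] -/
def mE : AExp := .beq (.emod eR (.lit 2)) (.lit 0)

/-- The flags `(first, last, tap, set0, set1, mirrored)` of a site. [folklore] -/
def siteFlags (E : AEnv) : Bool × Bool × Bool × Bool × Bool × Bool :=
  (fE.flag E, lE.flag E, tE.flag E, s0E.flag E && smE'.flag E, (s1aE.flag E && s1bE.flag E) && smE'.flag E, mE.flag E)

/-- The tile data of a site with given flags. [folklore] -/
def siteTD (b : Bool × Bool × Bool × Bool × Bool × Bool) : TileData :=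
  ((siteTile b.1 b.2.1 b.2.2.1 b.2.2.2.1 b.2.2.2.2.1 b.2.2.2.2.2).pos, (siteTile b.1 b.2.1 b.2.2.1 b.2.2.2.1 b.2.2.2.2.1 b.2.2.2.2.2).edges,
    siteNum b.1 b.2.1 b.2.2.1 b.2.2.2.1 b.2.2.2.2.1)

/-- The anchors of a site, as expressions. [folklore] -/
def siteAnchorsE : List AExp :=
  [.mul (.lit 5) (eBlIdx eR eS),
    .cond (.lt (.add eR (.lit 1)) eN) (.mul (.lit 5) (eBlIdx (.add eR (.lit 1)) (.lit 0))) (.mul (.lit 5) (eKIdx (.lit 0))),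
    eDlBase eR eS, eDlBase eR (.sub eS (.lit 1)),
    .add eBase2 (.mul (.lit 60) (.add (.mul (eJ eR eS) eN) eR)),
    .cond (.lt (.add eR (.lit 1)) eN) (.add eBase2 (.mul (.lit 60) (.add (.mul (eJ eR eS) eN) (.add eR (.lit 1)))))
      (.add eBase2 (.mul (.lit 12) (.add (.add (.mul (.lit 5) eNN) eN) (eJ eR eS)))),
    eSetBase eR]

/-- The `x`-coordinate and the negated `y`-coordinate of the origin of a site. [folklore] -/
def siteOrgE : AExp × AExp := (.mul (.lit 56) (eJ eR eS), .mul (.lit 100) (.add eR (.lit 1)))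

/-- A grid point from a natural `x` and a natural to negate for `y`. [folklore] -/
def orgOf (x y : ℕ) : GridPoint := ((x : ℤ), -(y : ℤ))

/-- **The placement data of site index `i`.** [folklore] -/
def sitePDF (E : AEnv) : PData :=
  mkPD (siteTD (siteFlags E)) (siteAnchorsE.map (AExp.eval E)) (orgOf (siteOrgE.1.eval E) (siteOrgE.2.eval E))

variable {φ : CNF ℕ}

/-- `decide (0 < s)` is `decide (1 ≤ s)`. [folklore] -/
theorem decide_pos_eq (s : ℕ) : decide (0 < s) = decide (1 ≤ s) := by rcases s with _ | s <;> rfl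

/-- The flags of site index `i = r N + s`. [folklore] -/
theorem siteFlags_env {i : ℕ} (hi : i < N φ * N φ) :
    siteFlags (env φ i) = (sF1 (i % N φ), sF2 φ (i % N φ), sF3 φ (i / N φ) (i % N φ), sF4 φ (i / N φ) (i % N φ),
      sF5 φ (i / N φ) (i % N φ), sMir (i / N φ)) := by
  obtain ⟨hr, hs, -, hN⟩ := hop_idx_lt (show 5 * i < 5 * (N φ * N φ) by omega)
  rw [show 5 * i / 5 = i by omega] at hr hs
  have hR : eR.eval (env φ i) = i / N φ := rfl
  have hS : eS.eval (env φ i) = i % N φ := rfl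
  unfold siteFlags sF1 sF2 sF3 sF4 sF5 sMir fE lE tE s0E s1aE s1bE smE' mE
  simp only [AExp.flag_beq, AExp.flag_lt, AExp.eval_lit, AExp.eval_add, AExp.eval_sub, AExp.eval_emod, ev_N, ev_J, hR, hS,
    flag_tap (show (eJ eR eS).eval (env φ i) < N φ by rw [ev_J, hR, hS]; exact J_lt hs), flag_isSome (show eR.eval (env φ i) < N φ from hr),
    Bool.decide_and, decide_pos_eq]

/-- The anchors of site index `i`. [folklore] -/
theorem siteAnchors_env (i : ℕ) : siteAnchorsE.map (AExp.eval (env φ i)) = (List.range 7).map (siteAnchor φ (i / N φ) (i % N φ)) := by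
  have hR : eR.eval (env φ i) = i / N φ := rfl
  have hS : eS.eval (env φ i) = i % N φ := rfl
  simp only [siteAnchorsE, List.map_cons, List.map_nil, List.range_succ_eq_map, List.range_zero, siteAnchor]
  simp only [AExp.eval_mul, AExp.eval_lit, AExp.eval_cond, AExp.eval_lt, AExp.eval_add, AExp.eval_sub, ev_N, ev_NN, ev_blIdx, ev_kIdx,
    ev_dlBase, ev_base2, ev_setBase, ev_J, hR, hS]
  refine List.cons_eq_cons.2 ⟨rfl, List.cons_eq_cons.2 ⟨?_, List.cons_eq_cons.2 ⟨rfl, List.cons_eq_cons.2 ⟨rfl, List.cons_eq_cons.2 ⟨rfl,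
    List.cons_eq_cons.2 ⟨?_, rfl⟩⟩⟩⟩⟩⟩
  · by_cases h : i / N φ + 1 < N φ <;> simp [h]
  · by_cases h : i / N φ + 1 < N φ <;> simp [h]

/-- The origin of site index `i`. [folklore] -/
theorem siteOrg_env (i : ℕ) : orgOf (siteOrgE.1.eval (env φ i)) (siteOrgE.2.eval (env φ i)) = sOrg φ (i / N φ) (i % N φ) := by
  unfold orgOf siteOrgE sOrg
  simp only [AExp.eval_mul, AExp.eval_lit, AExp.eval_add, ev_J]
  rfl

/-- **The placement data of site index `i` is the data of the site placement.** [folklore] -/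
theorem sitePDF_env {i : ℕ} (hi : i < N φ * N φ) : sitePDF (env φ i) = PData.ofPlacement (sitePl φ (i / N φ) (i % N φ)) := by
  unfold sitePDF mkPD PData.ofPlacement
  rw [siteFlags_env hi, siteAnchors_env, siteOrg_env]
  unfold siteTD sitePl sTile
  simp only
  refine Prod.ext rfl (Prod.ext rfl (Prod.ext rfl ?_))
  rw [nusOf_eq _ (by omega) (keys_site _ _ _ _ _)]
  rfl

/-- The code of six flags. [folklore] -/
abbrev flags6E : Bool × Bool × Bool × Bool × Bool × Bool → List Bool := pairE bitE (pairE bitE (pairE bitE (pairE bitE (pairE bitE bitE))))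

/-- The code of three flags. [folklore] -/
abbrev flags3E : Bool × Bool × Bool → List Bool := pairE bitE (pairE bitE bitE)

/-- Origins are typed polynomial time. [cite: AroraBarak2009, §1.3] -/
theorem codeFP_orgOf : CodeFP (pairE natE natE) gpC (fun q => orgOf q.1 q.2) :=
  ((smOfInt.comp (intOfNat.comp (fst _ _))).pair (smOfInt.comp (intNeg.comp (intOfNat.comp (snd _ _))))).congr fun _ => rfl

/-- **The placement data of a site is typed polynomial time** in the code of `φ` and the index
(no type ascriptions on the way: the maps are assembled bottom-up and compared once, by `rfl`). [cite: AroraBarak2009, §1.3] -/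
theorem codeFP_sitePDF : CodeFP (pairE cnfC natE) pdC (fun p => sitePDF (env p.1 p.2)) := by
  have henv := codeFP_env
  have hflags := (codeFP_flag' henv fE).pair ((codeFP_flag' henv lE).pair ((codeFP_flag' henv tE).pair
    (((codeFP_flag' henv s0E).and (codeFP_flag' henv smE')).pair ((((codeFP_flag' henv s1aE).and (codeFP_flag' henv s1bE)).and
      (codeFP_flag' henv smE')).pair (codeFP_flag' henv mE)))))
  have htd := (ofFintype (eα := flags6E) (pairE_injective bitE_injective (pairE_injective bitE_injective (pairE_injective bitE_injective
    (pairE_injective bitE_injective (pairE_injective bitE_injective bitE_injective))))) tdC siteTD).comp hflags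
  have hA := codeFP_evalList' henv siteAnchorsE
  have ho := codeFP_orgOf.comp ((codeFP_eval' henv siteOrgE.1).pair (codeFP_eval' henv siteOrgE.2))
  exact (codeFP_mkPD.comp (htd.pair (hA.pair ho))).congr fun _ => rfl

/-! ### Dummy pairs -/

/-- `first` dummy: `c = 0`. [folklore] -/
def dfE : AExp := .beq eIdx (.lit 0)
/-- `last` dummy: `c + 1 = N`. [folklore] -/
def dlE : AExp := .beq (.add eIdx (.lit 1)) eN
/-- Vacuous set ladder: no previous occurrence. [folklore] -/
def dvE : AExp := eIsNone eIdx

/-- The flags `(first, last, vacuous set ladder)` of dummy pair `c = i`. [folklore] -/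
def dummyFlags (E : AEnv) : Bool × Bool × Bool := (dfE.flag E, dlE.flag E, dvE.flag E)

/-- The tile data of a dummy pair with given flags. [folklore] -/
def dummyTD (b : Bool × Bool × Bool) : TileData :=
  ((dummyTile b.1 b.2.1 b.2.2).pos, (dummyTile b.1 b.2.1 b.2.2).edges, dummyNum b.1 b.2.1 b.2.2)

/-- The anchors of a dummy pair, as expressions. [folklore] -/
def dummyAnchorsE : List AExp :=
  [.mul (.lit 5) (.mul (.lit 2) eIdx), .mul (.lit 5) (eBlIdx (.lit 0) (.lit 0)), ePinBase (.mul (.lit 2) eIdx),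
    .add eBase2 (.mul (.lit 60) (.mul eIdx eN)), eSetBase eIdx]

/-- **The placement data of dummy pair `c = i`.** [folklore] -/
def dummyPDF (E : AEnv) : PData :=
  mkPD (dummyTD (dummyFlags E)) (dummyAnchorsE.map (AExp.eval E)) (orgOf ((AExp.mul (.lit 56) eIdx).eval E) 0)

/-- **The placement data of dummy pair `c` is the data of its placement.** [folklore] -/
theorem dummyPDF_env {c : ℕ} (hc : c < N φ) : dummyPDF (env φ c) = PData.ofPlacement (dummyPl φ c) := by
  have hflags : dummyFlags (env φ c) = (decide (c = 0), decide (c + 1 = N φ), (prev? φ c).isNone) := by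
    unfold dummyFlags dfE dlE dvE
    refine Prod.ext ?_ (Prod.ext ?_ ?_) <;> dsimp only
    · rw [AExp.flag_beq]; exact decide_eq_decide.mpr (by simp)
    · rw [AExp.flag_beq]; exact decide_eq_decide.mpr (by simp)
    · exact flag_isNone (show eIdx.eval (env φ c) < N φ from hc)
  have hA : dummyAnchorsE.map (AExp.eval (env φ c)) = (List.range 5).map (dummyAnchor φ c) := by
    simp only [dummyAnchorsE, List.map_cons, List.map_nil, List.range_succ_eq_map, List.range_zero, dummyAnchor]
    simp only [AExp.eval_mul, AExp.eval_lit, AExp.eval_add, ev_N, ev_Idx, ev_blIdx, ev_pinBase, ev_base2, ev_setBase]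
  unfold dummyPDF mkPD PData.ofPlacement
  rw [hflags, hA]
  unfold dummyTD dummyPl dTile orgOf
  simp only [AExp.eval_mul, AExp.eval_lit, ev_Idx]
  refine Prod.ext rfl (Prod.ext rfl (Prod.ext (by simp) ?_))
  rw [nusOf_eq _ (by omega) (keys_dummy _ _ _)]
  rfl

/-- **The placement data of a dummy pair is typed polynomial time.** [cite: AroraBarak2009, §1.3] -/
theorem codeFP_dummyPDF : CodeFP (pairE cnfC natE) pdC (fun p => dummyPDF (env p.1 p.2)) := by
  have henv := codeFP_env
  have hflags := (codeFP_flag' henv dfE).pair ((codeFP_flag' henv dlE).pair (codeFP_flag' henv dvE))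
  have htd := (ofFintype (eα := flags3E) (pairE_injective bitE_injective (pairE_injective bitE_injective bitE_injective)) tdC dummyTD).comp hflags
  have hA := codeFP_evalList' henv dummyAnchorsE
  have ho := codeFP_orgOf.comp ((codeFP_eval' henv (AExp.mul (.lit 56) eIdx)).pair (const (pairE cnfC natE) (0 : ℕ)))
  exact (codeFP_mkPD.comp (htd.pair (hA.pair ho))).congr fun _ => rfl

/-! ### The clause row -/

/-- The negated `y`-coordinate of the clause row. [folklore] -/
def eYK : AExp := .add (.mul (.lit 100) eN) (.lit 60)

/-- `yK`. [folklore] -/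
theorem ev_yK (i : ℕ) : -((eYK.eval (env φ i) : ℕ) : ℤ) = yK φ := by
  unfold yK; simp [eYK]

/-- The tile data of `K_0` with the polarity of the unit-clause literal. [folklore] -/
def k0TD (p : Bool) : TileData := ((k0Tile p).pos, (k0Tile p).edges, k0Num p)

/-- The anchors of the tile of `K_0`, as expressions. [folklore] -/
def k0AnchorsE : List AExp := [.mul (.lit 5) (eKIdx (.lit 0)), eKlinkBase (.lit 0), eClause1Base]

/-- **The placement data of the tile of `K_0`.** [folklore] -/
def k0PDF (E : AEnv) : PData := mkPD (k0TD ((ePol (.lit 0)).flag E)) (k0AnchorsE.map (AExp.eval E)) (orgOf 0 (eYK.eval E))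

/-- **The placement data of `K_0` is the data of its placement.** [folklore] -/
theorem k0PDF_env : k0PDF (env φ 0) = PData.ofPlacement (k0Pl φ) := by
  have hA : k0AnchorsE.map (AExp.eval (env φ 0)) = (List.range 3).map (k0Anchor φ) := by
    simp only [k0AnchorsE, List.map_cons, List.map_nil, List.range_succ_eq_map, List.range_zero, k0Anchor]
    simp only [AExp.eval_mul, AExp.eval_lit, ev_kIdx, ev_klinkBase, ev_clause1Base]
  unfold k0PDF mkPD PData.ofPlacement
  rw [flag_pol, hA]
  unfold k0TD k0Pl orgOf
  simp only [AExp.eval_lit, ev_yK]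
  refine Prod.ext rfl (Prod.ext rfl (Prod.ext (by simp) ?_))
  rw [nusOf_eq _ (by omega) (keys_k0 _)]
  rfl

/-- **The placement data of `K_0` is typed polynomial time.** [cite: AroraBarak2009, §1.3] -/
theorem codeFP_k0PDF : CodeFP (pairE cnfC natE) pdC (fun p => k0PDF (env p.1 p.2)) := by
  have henv := codeFP_env
  have htd := (ofFintype (eα := bitE) bitE_injective tdC k0TD).comp (codeFP_flag' henv (ePol (.lit 0)))
  have hA := codeFP_evalList' henv k0AnchorsE
  have ho := codeFP_orgOf.comp ((const (pairE cnfC natE) (0 : ℕ)).pair (codeFP_eval' henv eYK))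
  exact (codeFP_mkPD.comp (htd.pair (hA.pair ho))).congr fun _ => rfl

/-- The polarity of cell `3t + 1 + u` of clause `t = i`. [folklore] -/
def cpE (u : ℕ) : AExp := ePol (.add (.mul (.lit 3) eIdx) (.lit (u + 1)))

/-- The polarities of clause tile `t = i`. [folklore] -/
def clauseFlags (E : AEnv) : Bool × Bool × Bool := ((cpE 0).flag E, (cpE 1).flag E, (cpE 2).flag E)

/-- The tile data of a clause tile with given polarities. [folklore] -/
def clauseTD (b : Bool × Bool × Bool) : TileData :=
  ((clauseTile b.1 b.2.1 b.2.2).pos, (clauseTile b.1 b.2.1 b.2.2).edges, clauseNum b.1 b.2.1 b.2.2)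

/-- The anchors of a clause tile, as expressions. [folklore] -/
def clauseAnchorsE : List AExp :=
  [.mul (.lit 5) (eKIdx (.add (.mul (.lit 3) eIdx) (.lit 1))), eKlinkBase (.add (.mul (.lit 3) eIdx) (.lit 1)), eOr3Base eIdx]

/-- **The placement data of clause tile `t = i`.** [folklore] -/
def clausePDF (E : AEnv) : PData :=
  mkPD (clauseTD (clauseFlags E)) (clauseAnchorsE.map (AExp.eval E))
    (orgOf ((AExp.mul (.lit 56) (.add (.mul (.lit 3) eIdx) (.lit 1))).eval E) (eYK.eval E))

/-- **The placement data of clause tile `t` is the data of its placement.** [folklore] -/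
theorem clausePDF_env (t : ℕ) : clausePDF (env φ t) = PData.ofPlacement (clausePl φ t) := by
  have hflags : clauseFlags (env φ t) = cPols φ t := by
    unfold clauseFlags cPols cpE
    simp only [flag_pol, AExp.eval_add, AExp.eval_mul, AExp.eval_lit, ev_Idx]
  have hA : clauseAnchorsE.map (AExp.eval (env φ t)) = (List.range 3).map (clauseAnchor φ t) := by
    simp only [clauseAnchorsE, List.map_cons, List.map_nil, List.range_succ_eq_map, List.range_zero, clauseAnchor]
    simp only [AExp.eval_mul, AExp.eval_lit, AExp.eval_add, ev_Idx, ev_kIdx, ev_klinkBase, ev_or3Base]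
  unfold clausePDF mkPD PData.ofPlacement
  rw [hflags, hA]
  unfold clauseTD clausePl orgOf cν
  simp only [AExp.eval_lit, AExp.eval_mul, AExp.eval_add, ev_Idx, ev_yK]
  refine Prod.ext rfl (Prod.ext rfl (Prod.ext rfl ?_))
  rw [nusOf_eq _ (by omega) (keys_clause _ _ _)]

/-- **The placement data of a clause tile is typed polynomial time.** [cite: AroraBarak2009, §1.3] -/
theorem codeFP_clausePDF : CodeFP (pairE cnfC natE) pdC (fun p => clausePDF (env p.1 p.2)) := by
  have henv := codeFP_env
  have hflags := (codeFP_flag' henv (cpE 0)).pair ((codeFP_flag' henv (cpE 1)).pair (codeFP_flag' henv (cpE 2)))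
  have htd := (ofFintype (eα := flags3E) (pairE_injective bitE_injective (pairE_injective bitE_injective bitE_injective)) tdC clauseTD).comp hflags
  have hA := codeFP_evalList' henv clauseAnchorsE
  have ho := codeFP_orgOf.comp ((codeFP_eval' henv (AExp.mul (.lit 56) (.add (.mul (.lit 3) eIdx) (.lit 1)))).pair (codeFP_eval' henv eYK))
  exact (codeFP_mkPD.comp (htd.pair (hA.pair ho))).congr fun _ => rfl

/-- **The placement data of the end tile.** [folklore] -/
def zPDF (E : AEnv) : PData :=
  mkPD (zTile.pos, zTile.edges, zNum) [(AExp.mul (.lit 5) eZIdx).eval E] (orgOf ((AExp.mul (.lit 56) eN).eval E) (eYK.eval E))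

/-- **The placement data of the end tile is the data of its placement.** [folklore] -/
theorem zPDF_env : zPDF (env φ 0) = PData.ofPlacement (zPl φ) := by
  unfold zPDF mkPD PData.ofPlacement zPl orgOf
  simp only [AExp.eval_mul, AExp.eval_lit, ev_N, ev_zIdx, ev_yK]
  refine Prod.ext rfl (Prod.ext rfl (Prod.ext rfl ?_))
  rw [show [5 * zIdx φ] = (List.range 1).map (fun _ => 5 * zIdx φ) by simp, nusOf_eq _ (by omega) keys_z]

/-- **The placement data of the end tile is typed polynomial time.** [cite: AroraBarak2009, §1.3] -/
theorem codeFP_zPDF : CodeFP (pairE cnfC natE) pdC (fun p => zPDF (env p.1 p.2)) := by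
  have henv := codeFP_env
  have htd := const (pairE cnfC natE) (eβ := tdC) (zTile.pos, zTile.edges, zNum)
  have hA := codeFP_consNat (codeFP_eval' henv (AExp.mul (.lit 5) eZIdx)) (const (pairE cnfC natE) (eβ := rawE natE) ([] : List ℕ))
  have ho := codeFP_orgOf.comp ((codeFP_eval' henv (AExp.mul (.lit 56) eN)).pair (codeFP_eval' henv eYK))
  exact (codeFP_mkPD.comp (htd.pair (hA.pair ho))).congr fun _ => rfl

/-! ### All the placement data -/

variable (φ) in
/-- **The placement data of the drawing of `φ`**: dummies, sites row by row, the clause row. [folklore] -/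
def pdataList : List PData :=
  (List.range (N φ)).map (fun c => dummyPDF (env φ c)) ++ (List.range (N φ * N φ)).map (fun i => sitePDF (env φ i)) ++
    ([k0PDF (env φ 0)] ++ (List.range (T φ)).map (fun t => clausePDF (env φ t)) ++ [zPDF (env φ 0)])

/-- **The placement data are the data of the placements.** [folklore] -/
theorem pdataList_eq : pdataList φ = (placements φ).map PData.ofPlacement := by
  unfold pdataList placements
  simp only [List.map_append, List.map_map, List.map_cons, List.map_nil]
  congr 1
  · congr 1
    · exact List.map_congr_left fun c hc => dummyPDF_env (List.mem_range.1 hc)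
    · exact List.map_congr_left fun i hi => sitePDF_env (List.mem_range.1 hi)
  · rw [k0PDF_env, zPDF_env]
    congr 2
    exact List.map_congr_left fun t _ => clausePDF_env t

/-- A unary budget `N²`. [cite: AroraBarak2009, §1.3] -/
theorem codeFP_uNN : CodeFP cnfC unE (fun ψ => N ψ * N ψ) :=
  ((ulength unitE).comp ((unitsPow 2).comp (GridFormulaFP.codeFP_uN.congr gridN_eq))).congr fun ψ => by simp [pow_two]

/-- **The placement data of `φ` are typed polynomial time in the code of `φ`.** [cite: AroraBarak2009, §1.3] -/
theorem codeFP_pdataList : CodeFP cnfC (rawE pdC) pdataList := by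
  have huN : CodeFP cnfC unE N := GridFormulaFP.codeFP_uN.congr gridN_eq
  have hrN : CodeFP cnfC (rawE natE) (fun ψ => List.range (N ψ)) := urange.comp huN
  have hrNN : CodeFP cnfC (rawE natE) (fun ψ => List.range (N ψ * N ψ)) := urange.comp codeFP_uNN
  have h0 : CodeFP cnfC aenvE (fun ψ => env ψ 0) := (codeFP_env.comp ((CodeFP.id cnfC).pair (const cnfC (0 : ℕ)))).congr fun _ => rfl
  have hT : CodeFP cnfC natE T := (codeFP_eval' h0 eT).congr fun ψ => ev_T (φ := ψ) (i := 0)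
  have hrT : CodeFP cnfC (rawE natE) (fun ψ => List.range (T ψ)) :=
    (rangeOf.comp (huN.pair hT)).congr fun ψ => by dsimp only; rw [min_eq_left (by unfold T; omega)]
  have hD : CodeFP cnfC (rawE pdC) (fun ψ => (List.range (N ψ)).map fun c => dummyPDF (env ψ c)) :=
    ((map (g := fun t : CNF ℕ × ℕ => dummyPDF (env t.1 t.2)) codeFP_dummyPDF).comp ((CodeFP.id cnfC).pair hrN)).congr fun _ => rfl
  have hS : CodeFP cnfC (rawE pdC) (fun ψ => (List.range (N ψ * N ψ)).map fun i => sitePDF (env ψ i)) :=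
    ((map (g := fun t : CNF ℕ × ℕ => sitePDF (env t.1 t.2)) codeFP_sitePDF).comp ((CodeFP.id cnfC).pair hrNN)).congr fun _ => rfl
  have hC : CodeFP cnfC (rawE pdC) (fun ψ => (List.range (T ψ)).map fun t => clausePDF (env ψ t)) :=
    ((map (g := fun t : CNF ℕ × ℕ => clausePDF (env t.1 t.2)) codeFP_clausePDF).comp ((CodeFP.id cnfC).pair hrT)).congr fun _ => rfl
  have hK : CodeFP cnfC pdC (fun ψ => k0PDF (env ψ 0)) := (codeFP_k0PDF.comp ((CodeFP.id cnfC).pair (const cnfC (0 : ℕ)))).congr fun _ => rfl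
  have hZ : CodeFP cnfC pdC (fun ψ => zPDF (env ψ 0)) := (codeFP_zPDF.comp ((CodeFP.id cnfC).pair (const cnfC (0 : ℕ)))).congr fun _ => rfl
  -- (HO unification against expected types that mention the tile tables is ruinous: build bottom-up, compare by `rfl`)
  have hK1 : CodeFP cnfC (rawE pdC) (fun ψ => [k0PDF (env ψ 0)]) :=
    ((rawCons pdC).comp (hK.pair (const cnfC (eβ := rawE pdC) ([] : List PData)))).congr fun _ => rfl
  have hZ1 : CodeFP cnfC (rawE pdC) (fun ψ => [zPDF (env ψ 0)]) :=
    ((rawCons pdC).comp (hZ.pair (const cnfC (eβ := rawE pdC) ([] : List PData)))).congr fun _ => rfl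
  have h1 := (rawAppend pdC).comp (hD.pair hS)
  have h2 := (rawAppend pdC).comp (hK1.pair hC)
  have h3 := (rawAppend pdC).comp (h2.pair hZ1)
  have h4 := (rawAppend pdC).comp (h1.pair h3)
  exact h4.congr fun _ => rfl

/-! ### Budgets for the assembly -/

/-- A bound for the number of vertices. [folklore] -/
theorem totalV_le : totalV φ ≤ (N φ + 1) * (N φ + 1) * 200 := by
  have hT : T φ ≤ N φ := by unfold T; omega
  unfold totalV base2 clause1Base base1 M
  nlinarith [hT, Nat.zero_le (N φ)]

/-- **The number of vertices, in unary.** [cite: AroraBarak2009, §1.3] -/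
theorem codeFP_uTotalV : CodeFP cnfC unE totalV := by
  have hb : CodeFP cnfC unE (fun ψ => (N ψ + 1) * (N ψ + 1) * 200) :=
    ((ulength unitE).comp (unitsMul.comp (((unitsPow 2).comp (unSucc.comp (GridFormulaFP.codeFP_uN.congr gridN_eq))).pair
      (const _ (List.replicate 200 ()))))).congr
      fun ψ => by dsimp only; simp only [List.length_replicate]; ring
  have ht : CodeFP cnfC natE totalV :=
    (codeFP_eval' ((codeFP_env.comp ((CodeFP.id cnfC).pair (const cnfC (0 : ℕ)))).congr fun _ => rfl) eTotalV).congr fun ψ => ev_totalV (φ := ψ) (i := 0)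
  exact (unOfNatMin.comp (hb.pair ht)).congr fun ψ => min_eq_left (totalV_le (φ := ψ))

/-- The far end `5M - 1`, in binary. [cite: AroraBarak2009, §1.3] -/
theorem codeFP_tEnd : CodeFP cnfC natE (fun ψ => 5 * M ψ - 1) :=
  (codeFP_eval' ((codeFP_env.comp ((CodeFP.id cnfC).pair (const cnfC (0 : ℕ)))).congr fun _ => rfl) (.sub (.mul (.lit 5) eM) (.lit 1))).congr
    fun ψ => by simp

end LOTDrawingFP

end Literature.Barriers.CriticalPhenomena.GridSAW
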